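import Summits.AtomisticToContinuum.BoseEinsteinCondensation.Theses.BECStronglyRayleigh
import Summits.AtomisticToContinuum.BoseEinsteinCondensation.Theorems.BECStronglyRayleighLatticeCoherenceAssemblyGroundSpace
import Summits.AtomisticToContinuum.BoseEinsteinCondensation.Theorems.BECStronglyRayleighLatticeCoherenceAssemblyLowerNorm
import Summits.AtomisticToContinuum.BoseEinsteinCondensation.Theorems.BECStronglyRayleighSectorGroundStatePerron
import Summits.AtomisticToContinuum.BoseEinsteinCondensation.Theorems.BECStronglyRayleighPenaltySelectsSector
import Literature.MathematicalPhysics.QuantumLattice.LiebMattisSectorPF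
import Literature.MathematicalPhysics.QuantumLattice.ApproximateEigenvectorLemmas
import HarnessLib

/-!
# Stub `stub_transfer` (line `Sketch`, crux `KineticLatticeBEC`, stmt-AtomisticToContinuum-9671)

Transfer step of the sector-ladder line: a uniform bound `c·N·L³·‖ψ‖² ≤ ‖Ŝ⁻_tot ψ‖²` over the
nonzero entrywise-nonnegative ground vectors `ψ` of the sectors `Ŝᶻ_tot = N − L³/2` of
`xyTorus 3 L 1` (`1 ≤ N ≤ L³/2`, `L ≥ max L₀ 2`) implies the crux `KineticLatticeBEC` with the same
`c` and threshold `max L₀ 2`. The tracial ground state of the penalised Hamiltonian is the vector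
state of the sector Perron vector (`LatticeCoherence.groundState_penalised` with the proved supports
`SectorGroundStatePerron_proof`, `PenaltySelectsSector_proof`), and on the sector
`Re⟨ψ, ((Ŝˣ)²+(Ŝʸ)²)ψ⟩ + (N − L³/2)‖ψ‖² = ‖Ŝ⁻ψ‖²` (`LatticeCoherence.re_inner_planar_add`).
-/

noncomputable section

namespace Summit.AtomisticToContinuum.BoseEinsteinCondensation.Cruxes.KineticLatticeBEC.SectorLadder

open scoped BigOperators Matrix ComplexOrder
open Literature.MathematicalPhysics.QuantumLattice Literature.Probability.LatticeModels Matrix Complex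
open Summit.AtomisticToContinuum.BoseEinsteinCondensation.Theses.BECStronglyRayleigh

/-- **Stub D — transfer.** A uniform bound `c·N·L³·‖ψ‖² ≤ ‖Ŝ⁻ψ‖²` over all nonzero
entrywise-nonnegative ground vectors `ψ` of the sectors `N − L³/2`, `1 ≤ N ≤ L³/2`, `L ≥ max(L₀,2)`, of
`xyTorus 3 L 1` implies `KineticLatticeBEC` with the same `c`: the penalised Hamiltonian's tracial ground
state is the vector state of the sector Perron vector (`LatticeCoherence.groundState_penalised` with the
proved supports `SectorGroundStatePerron_proof`, `PenaltySelectsSector_proof`), and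
`Re⟨ψ, ((Ŝˣ)²+(Ŝʸ)²)ψ⟩ + (N − L³/2)‖ψ‖² = ‖Ŝ⁻ψ‖²` (`LatticeCoherence.re_inner_planar_add`). [folklore] -/
theorem stub_transfer (c : ℝ) (hc : 0 < c) (L₀ : ℕ)
    (h : ∀ (L : ℕ) [NeZero L], L₀ ≤ L → 2 ≤ L → ∀ N : ℕ, 1 ≤ N → 2 * N ≤ L ^ 3 →
      ∀ ψ : TensorIndex (TorusSite 3 L) 2 → ℂ,
        ψ ≠ 0 → (∀ σ, 0 ≤ (ψ σ).re ∧ (ψ σ).im = 0) →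
        ψ ∈ spinZSector 1 ((N : ℝ) - (L : ℝ) ^ 3 / 2) →
        (xyTorus 3 L 1) *ᵥ ψ =
          ((lowestEnergyInSector 1 (xyTorus 3 L 1) ((N : ℝ) - (L : ℝ) ^ 3 / 2) : ℝ) : ℂ) • ψ →
        c * N * (L : ℝ) ^ 3 * (star ψ ⬝ᵥ ψ).re ≤
          (star ((totalSpin 1 0 - I • totalSpin 1 1 : Op (TorusSite 3 L) 2) *ᵥ ψ) ⬝ᵥ
            ((totalSpin 1 0 - I • totalSpin 1 1 : Op (TorusSite 3 L) 2) *ᵥ ψ)).re) :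
    KineticLatticeBEC := by
  refine ⟨c, hc, max L₀ 2, fun L _ hL _hEven N hN1 h2N => ?_⟩
  have hL₀ : L₀ ≤ L := le_trans (le_max_left _ _) hL
  have hL2 : 2 ≤ L := le_trans (le_max_right _ _) hL
  have hN : N ≤ L ^ 3 := by omega
  -- the Perron vector of the sector is THE ground state of the penalised Hamiltonian
  obtain ⟨ψ, hψ0, hψnn, hψsec, hHψ, -, hgsf⟩ :=
    Summit.AtomisticToContinuum.BoseEinsteinCondensation.Theorems.LatticeCoherence.groundState_penalised
      Summit.AtomisticToContinuum.BoseEinsteinCondensation.Theorems.SectorGroundStatePerron_proof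
      Summit.AtomisticToContinuum.BoseEinsteinCondensation.Theorems.PenaltySelectsSector_proof
      3 L N (by norm_num) hL2 hN
  -- the hypothesis at `ψ`
  have hb := h L hL₀ hL2 N hN1 h2N ψ hψ0 hψnn hψsec hHψ
  -- `Re⟨ψ, ((Ŝˣ)²+(Ŝʸ)²)ψ⟩ + (N − L³/2)‖ψ‖² = ‖Ŝ⁻ψ‖²`
  have hpl :=
    Summit.AtomisticToContinuum.BoseEinsteinCondensation.Theorems.LatticeCoherence.re_inner_planar_add
      ((N : ℝ) - (L : ℝ) ^ 3 / 2) ψ hψsec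
  have hpos : 0 < (star ψ ⬝ᵥ ψ).re := EigenvalueContinuation.re_star_dotProduct_self_pos hψ0
  -- `⟨ψ, ψ⟩` is real
  have hreal : star ψ ⬝ᵥ ψ = (((star ψ ⬝ᵥ ψ).re : ℝ) : ℂ) :=
    Complex.ext (by simp) (by simp [EigenvalueContinuation.im_star_dotProduct_self])
  rw [hgsf, hreal, Complex.div_ofReal_re]
  -- divide the hypothesis by `‖ψ‖² > 0`
  set a : ℝ := (star ψ ⬝ᵥ ψ).re with ha
  set q : ℝ := (star ψ ⬝ᵥ (totalSpin 1 0 * totalSpin 1 0 + totalSpin 1 1 * totalSpin 1 1 :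
    Op (TorusSite 3 L) 2) *ᵥ ψ).re with hq
  have key : c * N * (L : ℝ) ^ 3 * a ≤ (q / a + N - (L : ℝ) ^ 3 / 2) * a := by
    have : (q / a + N - (L : ℝ) ^ 3 / 2) * a = q + ((N : ℝ) - (L : ℝ) ^ 3 / 2) * a := by
      field_simp
      ring
    rw [this, hpl]
    exact hb
  exact le_of_mul_le_mul_right key hpos

end Summit.AtomisticToContinuum.BoseEinsteinCondensation.Cruxes.KineticLatticeBEC.SectorLadder
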